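import Literature.Probability.LatticeModels.MedialCycleSeparation
import Literature.Topology.PlaneTopology.PolygonUmlaufsatz
import Mathlib.Analysis.SpecialFunctions.Complex.Arg
import HarnessLib

/-!
# The perturbed polygon of a cycle of the turning rule is simple; its total turning is `(π/2) ∑ turnSign`

Topic `Literature/Probability/LatticeModels`; companion of the discharge programme for
crit-ising.S18, node 1 (s-holomorphicity of the critical FK-Ising observable, corrected form
`isSHolomorphic_fkIsingObservable_of_zdArcA_connected`). The planar fact T2 `medialCycle_turning`
of `WeightTable.lean` (around a cycle of minimal period `Q` of the turning rule `nextCorner β`,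
`∑_{m<Q} turnSign β (orb m) = ±4`) is a theorem of the tree (`medialCycle_turning_holds`,
`MedialCycleHopf.lean`, by a discrete Umlaufsatz for lattice walks). This file gives the
**second, polygonal route** announced in `WeightTable.lean` and `PolygonUmlaufsatz.lean`
(`medialCycle_turning_of_polygonUmlaufsatz`), whose by-products are new: the closed perturbed
polygon of a cycle (the `cyLoop` of `MedialCycleSeparation.lean`) **is a simple closed polygon**
(`isSimplePolygon_cycVert` — the injectivity statement the T1/T2 files never needed to spell out)
and its exterior angles are tabulated. Hopf's Umlaufsatz for simple closed polygons
(`Literature.Topology.PlaneTopology.IsSimplePolygon.sum_extAngle_eq`, `PolygonUmlaufsatz.lean`;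
H. Hopf, Compositio Math. 2 (1935), Satz I) is applied to:

* `sPt p = v + I^k (3 + i)/8`, `tPt p = v + I^k (1 + 3i)/8` for the coded corner `p = (v, k)`:
  the shifted source and target points of the dart (at `3/8` from `v` along the source, resp.
  target, edge and `1/8` inside the face). These ARE the vertices `cyS`, `cyT` of the closed
  perturbed polygon `cyLoop` of `MedialCycleSeparation.lean` (built from `dartPt` of
  `MedialPerturbation.lean`): `cyS_eq_sPt`, `cyT_eq_tPt` (via `sPt_eq_dartPt`, `tPt_eq_dartPt`);
  the complex closed form is what makes the rotation `I^{-k}` below a one-liner.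
  The polygon of the cycle runs `sPt (orb 0), tPt (orb 0), sPt (orb 1), tPt (orb 1), …`
  (`pieceVert`, `cycVert`; period `2Q`): dart pieces `[sPt p, tPt p]` alternate with
  connectors `[tPt p, sPt (nextCorner β p)]`, which are `v + I^k [dT, vE]` across a closed edge
  (vertex turn) and `v + I^k [dT, fE]` along an open one (face turn) (`sPt_nextCorner_of_not_mem`,
  `sPt_nextCorner_of_mem`).
* **Exterior angles** (`extAngle` of `PolygonUmlaufsatz.lean`, which is `turning` of
  `FermionicObservable.lean` by `rfl`, `extAngle_eq_turning`): a vertex turn contributes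
  `π/4 + π/4`, a face turn `-π/4 - π/4`, i.e. each turn contributes `(π/2) · turnSign`
  (`arg_at_tPt`, `arg_at_sPt`, `extAngle_pair`, `sum_extAngle_cycVert`).
* **Simplicity**: after rotating by `I^{-k}` and translating, two pieces meet only in the
  tabulated cases (`std_DD`, `std_DV`, `std_DF`, `std_VV`, `std_FF`, `std_VF`: same corner, or
  the connector leading into the dart), which for a cycle of a *permutation* are exactly the
  cyclically adjacent pieces (`isSimplePolygon_cycVert`).
* Hence `(π/2) ∑ turnSign = ±2π` (`medialCycle_turning_of_polygonUmlaufsatz`, a second proof of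
  the statement of `medialCycle_turning_holds`). The corrected node-1 fact itself is discharged in
  `FKInterfacePairingProofs.lean` (`isSHolomorphic_fkIsingObservable_of_zdArcA_connected_holds`).

All statements here are proved; the only inputs are the cited Umlaufsatz (proved in the tree) and
the earlier instalments.
-/

noncomputable section

open Complex Set Finset Literature.Topology.PlaneTopology

namespace Literature.Probability.LatticeModels

/-! ### The bridge to `turning` -/

/-- **Bridge.** The exterior angle `extAngle z i` of `PolygonUmlaufsatz.lean` is the turning angle
`turning (z (i-1)) (z i) (z (i+1))` of `FermionicObservable.lean`, by `rfl`. [folklore] -/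
theorem extAngle_eq_turning (z : ℤ → ℂ) (i : ℤ) : extAngle z i = turning (z (i - 1)) (z i) (z (i + 1)) := rfl

/-! ### Lattice points as Gaussian integers -/

/-- `Site.toComplex` is injective (coordinates: `Percolation.coordVec_toComplex`). [folklore] -/
theorem toComplex_injective_site : Function.Injective (Site.toComplex : Site 2 → ℂ) := by
  intro x y h
  ext k
  have := congrArg (fun z => Percolation.coordVec z k) h
  simpa using this

/-- **Rotating a lattice vector back by `I^{-k}` gives a lattice vector**: every `d ∈ ℤ²` is
`I^k u` for some `u ∈ ℤ²`. [folklore] -/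
theorem exists_toComplex_eq_I_pow_mul (d : Site 2) (k : Fin 4) :
    ∃ u : Site 2, Site.toComplex d = I ^ (k : ℕ) * Site.toComplex u := by
  fin_cases k
  · exact ⟨d, by simp⟩
  · refine ⟨![d 1, -d 0], ?_⟩
    apply Complex.ext <;> simp [Site.toComplex]
  · refine ⟨-d, ?_⟩
    apply Complex.ext <;> simp [Site.toComplex]
  · refine ⟨![-d 1, d 0], ?_⟩
    apply Complex.ext <;> simp [Site.toComplex, pow_succ]

/-- Powers of `I` indexed by `Fin 4` are multiplicative in the index. [folklore] -/
theorem I_pow_fin_add (a b : Fin 4) : I ^ ((a + b : Fin 4) : ℕ) = I ^ (a : ℕ) * I ^ (b : ℕ) := by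
  rw [← pow_add, Fin.val_add]
  conv_rhs => rw [← Nat.mod_add_div ((a : ℕ) + b) 4, pow_add, pow_mul, Complex.I_pow_four, one_pow, mul_one]

/-! ### The standard pieces -/

/-- Standard shifted source point `(3 + i)/8` (corner at the origin, source edge along `1`,
target edge along `i`). [folklore] -/
def dS : ℂ := ⟨3 / 8, 1 / 8⟩

/-- Standard shifted target point `(1 + 3i)/8`. [folklore] -/
def dT : ℂ := ⟨1 / 8, 3 / 8⟩

/-- End of the standard vertex connector, `(-1 + 3i)/8 = I • dS`. [folklore] -/
def vE : ℂ := ⟨-(1 / 8), 3 / 8⟩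

/-- End of the standard face connector, `(1 + 5i)/8 = I + I³ • dS`. [folklore] -/
def fE : ℂ := ⟨1 / 8, 5 / 8⟩

/-- Coordinate of `dS`. [folklore] -/
@[simp] theorem dS_re : dS.re = 3 / 8 := rfl
/-- Coordinate of `dS`. [folklore] -/
@[simp] theorem dS_im : dS.im = 1 / 8 := rfl
/-- Coordinate of `dT`. [folklore] -/
@[simp] theorem dT_re : dT.re = 1 / 8 := rfl
/-- Coordinate of `dT`. [folklore] -/
@[simp] theorem dT_im : dT.im = 3 / 8 := rfl
/-- Coordinate of `vE`. [folklore] -/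
@[simp] theorem vE_re : vE.re = -(1 / 8) := rfl
/-- Coordinate of `vE`. [folklore] -/
@[simp] theorem vE_im : vE.im = 3 / 8 := rfl
/-- Coordinate of `fE`. [folklore] -/
@[simp] theorem fE_re : fE.re = 1 / 8 := rfl
/-- Coordinate of `fE`. [folklore] -/
@[simp] theorem fE_im : fE.im = 5 / 8 := rfl

/-- The standard dart piece `[dS, dT]`. [folklore] -/
def stdD : Set ℂ := segment ℝ dS dT

/-- The standard vertex connector `[dT, vE]`. [folklore] -/
def stdV : Set ℂ := segment ℝ dT vE

/-- The standard face connector `[dT, fE]`. [folklore] -/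
def stdF : Set ℂ := segment ℝ dT fE

/-- Coordinates along the standard dart piece. [folklore] -/
theorem re_im_of_mem_stdD {x : ℂ} (hx : x ∈ stdD) :
    ∃ s : ℝ, 0 ≤ s ∧ s ≤ 1 ∧ x.re = 3 / 8 - s / 4 ∧ x.im = 1 / 8 + s / 4 := by
  rw [stdD, segment_eq_image'] at hx
  obtain ⟨s, ⟨hs0, hs1⟩, rfl⟩ := hx
  refine ⟨s, hs0, hs1, ?_, ?_⟩
  · simp only [add_re, sub_re, Complex.smul_re, smul_eq_mul, dS_re, dT_re]; ring
  · simp only [add_im, sub_im, Complex.smul_im, smul_eq_mul, dS_im, dT_im]; ring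

/-- Coordinates along the standard vertex connector. [folklore] -/
theorem re_im_of_mem_stdV {x : ℂ} (hx : x ∈ stdV) :
    ∃ s : ℝ, 0 ≤ s ∧ s ≤ 1 ∧ x.re = 1 / 8 - s / 4 ∧ x.im = 3 / 8 := by
  rw [stdV, segment_eq_image'] at hx
  obtain ⟨s, ⟨hs0, hs1⟩, rfl⟩ := hx
  refine ⟨s, hs0, hs1, ?_, ?_⟩
  · simp only [add_re, sub_re, Complex.smul_re, smul_eq_mul, dT_re, vE_re]; ring
  · simp only [add_im, sub_im, Complex.smul_im, smul_eq_mul, dT_im, vE_im]; ring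

/-- Coordinates along the standard face connector. [folklore] -/
theorem re_im_of_mem_stdF {x : ℂ} (hx : x ∈ stdF) :
    ∃ s : ℝ, 0 ≤ s ∧ s ≤ 1 ∧ x.re = 1 / 8 ∧ x.im = 3 / 8 + s / 4 := by
  rw [stdF, segment_eq_image'] at hx
  obtain ⟨s, ⟨hs0, hs1⟩, rfl⟩ := hx
  refine ⟨s, hs0, hs1, ?_, ?_⟩
  · simp only [add_re, sub_re, Complex.smul_re, smul_eq_mul, dT_re, fE_re]; ring
  · simp only [add_im, sub_im, Complex.smul_im, smul_eq_mul, dT_im, fE_im]; ring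

/-- Real and imaginary parts of `z = u + I^r y` for the four values of `r`. [folklore] -/
theorem reim_cases (u : Site 2) (r : Fin 4) (y : ℂ) {z : ℂ} (h : z = Site.toComplex u + I ^ (r : ℕ) * y) :
    (r = 0 ∧ z.re = u 0 + y.re ∧ z.im = u 1 + y.im) ∨ (r = 1 ∧ z.re = u 0 - y.im ∧ z.im = u 1 + y.re) ∨
      (r = 2 ∧ z.re = u 0 - y.re ∧ z.im = u 1 - y.im) ∨ (r = 3 ∧ z.re = u 0 + y.im ∧ z.im = u 1 - y.re) := by
  subst h
  fin_cases r
  · left; exact ⟨rfl, by simp, by simp⟩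
  · right; left; exact ⟨rfl, by simp [sub_eq_add_neg], by simp⟩
  · right; right; left; exact ⟨rfl, by simp [sub_eq_add_neg], by simp [sub_eq_add_neg]⟩
  · right; right; right; refine ⟨rfl, by simp [pow_succ], by simp [pow_succ, sub_eq_add_neg]⟩

/-- Trichotomy of an integer against `0`, in real form (for `linarith`). [folklore] -/
private theorem int_tri (a : ℤ) : (a : ℝ) ≤ -1 ∨ (a = 0 ∧ (a : ℝ) = 0) ∨ (1 : ℝ) ≤ a := by
  rcases lt_trichotomy a 0 with h | h | h
  · left; exact_mod_cast (show a ≤ -1 by omega)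
  · exact Or.inr (Or.inl ⟨h, by rw [h]; simp⟩)
  · right; right; exact_mod_cast (show 1 ≤ a by omega)

/-- A site with vanishing coordinates is `0`. [folklore] -/
private theorem site_eq_zero {u : Site 2} (h0 : u 0 = 0) (h1 : u 1 = 0) : u = 0 := by
  ext i; fin_cases i <;> simp [h0, h1]

/-- A site from its two coordinates. [folklore] -/
private theorem site_eq_of {u : Site 2} {a b : ℤ} (h0 : u 0 = a) (h1 : u 1 = b) : u = ![a, b] := by
  ext i; fin_cases i <;> simp [h0, h1]

/-! ### The intersection table of the standard pieces

Two pieces `x ∈ stdX` and `u + I^r y`, `y ∈ stdY` (`u ∈ ℤ²`, `r ∈ ℤ/4`), can coincide only in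
the listed cases; the proofs are coordinate comparisons (both coordinates of every piece lie in
`(1/8)ℤ + [0, 1/4]`). -/

section Table

variable {u : Site 2} {r : Fin 4} {x y : ℂ}

/-- Dart against dart: only the same corner. [folklore] -/
theorem std_DD (hx : x ∈ stdD) (hy : y ∈ stdD) (h : x = Site.toComplex u + I ^ (r : ℕ) * y) : u = 0 ∧ r = 0 := by
  obtain ⟨s, hs0, hs1, hxr, hxi⟩ := re_im_of_mem_stdD hx
  obtain ⟨t, ht0, ht1, hyr, hyi⟩ := re_im_of_mem_stdD hy
  rcases reim_cases u r y h with ⟨rfl, hre, him⟩ | ⟨rfl, hre, him⟩ | ⟨rfl, hre, him⟩ | ⟨rfl, hre, him⟩ <;>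
    rcases int_tri (u 0) with h0 | ⟨h0, h0'⟩ | h0 <;> rcases int_tri (u 1) with h1 | ⟨h1, h1'⟩ | h1 <;>
    first
    | (exfalso; linarith)
    | exact ⟨site_eq_zero h0 h1, rfl⟩

/-- Dart against vertex connector: the same corner (meeting at `dT`), or the connector from the
previous face around the same vertex (`r = 3`, meeting at `dS`). [folklore] -/
theorem std_DV (hx : x ∈ stdD) (hy : y ∈ stdV) (h : x = Site.toComplex u + I ^ (r : ℕ) * y) :
    u = 0 ∧ (r = 0 ∨ r = 3) := by
  obtain ⟨s, hs0, hs1, hxr, hxi⟩ := re_im_of_mem_stdD hx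
  obtain ⟨t, ht0, ht1, hyr, hyi⟩ := re_im_of_mem_stdV hy
  rcases reim_cases u r y h with ⟨rfl, hre, him⟩ | ⟨rfl, hre, him⟩ | ⟨rfl, hre, him⟩ | ⟨rfl, hre, him⟩ <;>
    rcases int_tri (u 0) with h0 | ⟨h0, h0'⟩ | h0 <;> rcases int_tri (u 1) with h1 | ⟨h1, h1'⟩ | h1 <;>
    first
    | (exfalso; linarith)
    | exact ⟨site_eq_zero h0 h1, by decide⟩

/-- Dart against face connector: the same corner (meeting at `dT`), or the connector along the
source edge from its other endpoint (`u = 1`, `r = 1`, meeting at `dS`). [folklore] -/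
theorem std_DF (hx : x ∈ stdD) (hy : y ∈ stdF) (h : x = Site.toComplex u + I ^ (r : ℕ) * y) :
    (u = 0 ∧ r = 0) ∨ (u = ![1, 0] ∧ r = 1) := by
  obtain ⟨s, hs0, hs1, hxr, hxi⟩ := re_im_of_mem_stdD hx
  obtain ⟨t, ht0, ht1, hyr, hyi⟩ := re_im_of_mem_stdF hy
  rcases reim_cases u r y h with ⟨rfl, hre, him⟩ | ⟨rfl, hre, him⟩ | ⟨rfl, hre, him⟩ | ⟨rfl, hre, him⟩ <;>
    rcases int_tri (u 0) with h0 | ⟨h0, h0'⟩ | h0 <;> rcases int_tri (u 1) with h1 | ⟨h1, h1'⟩ | h1 <;>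
    first
    | (exfalso; linarith)
    | exact Or.inl ⟨site_eq_zero h0 h1, rfl⟩
    | (right
       refine ⟨site_eq_of ?_ h1, rfl⟩
       have : (u 0 : ℝ) ≤ 1 := by linarith
       exact le_antisymm (by exact_mod_cast this) (by exact_mod_cast h0))

/-- Vertex connector against vertex connector: only the same corner. [folklore] -/
theorem std_VV (hx : x ∈ stdV) (hy : y ∈ stdV) (h : x = Site.toComplex u + I ^ (r : ℕ) * y) : u = 0 ∧ r = 0 := by
  obtain ⟨s, hs0, hs1, hxr, hxi⟩ := re_im_of_mem_stdV hx
  obtain ⟨t, ht0, ht1, hyr, hyi⟩ := re_im_of_mem_stdV hy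
  rcases reim_cases u r y h with ⟨rfl, hre, him⟩ | ⟨rfl, hre, him⟩ | ⟨rfl, hre, him⟩ | ⟨rfl, hre, him⟩ <;>
    rcases int_tri (u 0) with h0 | ⟨h0, h0'⟩ | h0 <;> rcases int_tri (u 1) with h1 | ⟨h1, h1'⟩ | h1 <;>
    first
    | (exfalso; linarith)
    | exact ⟨site_eq_zero h0 h1, rfl⟩

/-- Face connector against face connector: only the same corner. [folklore] -/
theorem std_FF (hx : x ∈ stdF) (hy : y ∈ stdF) (h : x = Site.toComplex u + I ^ (r : ℕ) * y) : u = 0 ∧ r = 0 := by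
  obtain ⟨s, hs0, hs1, hxr, hxi⟩ := re_im_of_mem_stdF hx
  obtain ⟨t, ht0, ht1, hyr, hyi⟩ := re_im_of_mem_stdF hy
  rcases reim_cases u r y h with ⟨rfl, hre, him⟩ | ⟨rfl, hre, him⟩ | ⟨rfl, hre, him⟩ | ⟨rfl, hre, him⟩ <;>
    rcases int_tri (u 0) with h0 | ⟨h0, h0'⟩ | h0 <;> rcases int_tri (u 1) with h1 | ⟨h1, h1'⟩ | h1 <;>
    first
    | (exfalso; linarith)
    | exact ⟨site_eq_zero h0 h1, rfl⟩

/-- Vertex connector against face connector: the same corner (both starting at `dT`), or the face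
connector coming along the crossed edge from its other endpoint (`u = i`, `r = 2`, both ending at
`vE`); both are excluded for one configuration (the edge would be closed and open). [folklore] -/
theorem std_VF (hx : x ∈ stdV) (hy : y ∈ stdF) (h : x = Site.toComplex u + I ^ (r : ℕ) * y) :
    (u = 0 ∧ r = 0) ∨ (u = ![0, 1] ∧ r = 2) := by
  obtain ⟨s, hs0, hs1, hxr, hxi⟩ := re_im_of_mem_stdV hx
  obtain ⟨t, ht0, ht1, hyr, hyi⟩ := re_im_of_mem_stdF hy
  rcases reim_cases u r y h with ⟨rfl, hre, him⟩ | ⟨rfl, hre, him⟩ | ⟨rfl, hre, him⟩ | ⟨rfl, hre, him⟩ <;>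
    rcases int_tri (u 0) with h0 | ⟨h0, h0'⟩ | h0 <;> rcases int_tri (u 1) with h1 | ⟨h1, h1'⟩ | h1 <;>
    first
    | (exfalso; linarith)
    | exact Or.inl ⟨site_eq_zero h0 h1, rfl⟩
    | (right
       refine ⟨site_eq_of h0 ?_, rfl⟩
       have : (u 1 : ℝ) ≤ 1 := by linarith
       exact le_antisymm (by exact_mod_cast this) (by exact_mod_cast h1))

end Table

/-! ### The shifted points of a coded corner and the pieces of a cycle -/

/-- The shifted source point of the coded corner `p = (v, k)`: `v + I^k dS`, the point of the
source edge at `3/8` from `v`, pushed by `1/8` into the face. [folklore] -/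
def sPt (p : Site 2 × Fin 4) : ℂ := Site.toComplex p.1 + I ^ (p.2 : ℕ) * dS

/-- The shifted target point of `p = (v, k)`: `v + I^k dT`. [folklore] -/
def tPt (p : Site 2 × Fin 4) : ℂ := Site.toComplex p.1 + I ^ (p.2 : ℕ) * dT

/-- `I • dS = vE`. [folklore] -/
theorem I_mul_dS : I * dS = vE := by apply Complex.ext <;> simp

/-- `I + I³ • dS = fE`. [folklore] -/
theorem I_add_I_pow_three_mul_dS : I + I ^ 3 * dS = fE := by
  apply Complex.ext <;> norm_num [pow_succ]

/-- **Vertex turn**: the source point of the next corner around the same vertex is `v + I^k vE`.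
[folklore] -/
theorem sPt_vertexTurn (v : Site 2) (k : Fin 4) : sPt (v, k + 1) = Site.toComplex v + I ^ (k : ℕ) * vE := by
  rw [sPt, ← I_mul_dS, ← mul_assoc, ← I_pow_fin_succ]

/-- **Face turn**: the source point of the next corner along the followed edge is `v + I^k fE`.
[folklore] -/
theorem sPt_faceTurn (v : Site 2) (k : Fin 4) :
    sPt (v + cornerUnit (k + 1), k + 3) = Site.toComplex v + I ^ (k : ℕ) * fE := by
  rw [sPt, ← I_add_I_pow_three_mul_dS]
  simp only
  rw [Percolation.toComplex_add, toComplex_cornerUnit_succ, I_pow_fin_add, show ((3 : Fin 4) : ℕ) = 3 from rfl]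
  ring

/-- The connector after a corner with closed target edge ends at `v + I^k vE`. [cite: Smirnov2001, §2] -/
theorem sPt_nextCorner_of_not_mem {β : Percolation.BondConfig (Site 2)} {p : Site 2 × Fin 4} (h : cTgt p ∉ β) :
    sPt (nextCorner β p) = Site.toComplex p.1 + I ^ (p.2 : ℕ) * vE := by
  rw [nextCorner_of_not_mem h]; exact sPt_vertexTurn p.1 p.2

/-- The connector after a corner with open target edge ends at `v + I^k fE`. [cite: Smirnov2001, §2] -/
theorem sPt_nextCorner_of_mem {β : Percolation.BondConfig (Site 2)} {p : Site 2 × Fin 4} (h : cTgt p ∈ β) :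
    sPt (nextCorner β p) = Site.toComplex p.1 + I ^ (p.2 : ℕ) * fE := by
  rw [nextCorner_of_mem h]; exact sPt_faceTurn p.1 p.2

/-! ### Bridge: these are the shifted points `cyS`, `cyT` of `MedialCycleSeparation.lean` -/

/-- An impossible `if`. [folklore] -/
private theorem ite_eq_sub_one {α : Type*} (a : ℤ) (x y : α) : (if a = a - 1 then x else y) = y := if_neg (by omega)

/-- `sPt` at face index `0` is the shifted source point of `MedialPerturbation`. [folklore] -/
private theorem sPt_zero (v : Site 2) : sPt (v, 0) = dartPt v (faceAt v 0) (srcDir v (faceAt v 0)) := by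
  simp [faceAt, cornerOff, srcDir, dartPt, toward, inward, sPt, dS, Site.toComplex, Complex.ext_iff]

/-- `sPt` at face index `1` is the shifted source point of `MedialPerturbation`. [folklore] -/
private theorem sPt_one (v : Site 2) : sPt (v, 1) = dartPt v (faceAt v 1) (srcDir v (faceAt v 1)) := by
  simp [faceAt, cornerOff, srcDir, dartPt, toward, inward, sPt, dS, Site.toComplex, Complex.ext_iff, ite_eq_sub_one]
  ring

/-- `sPt` at face index `2` is the shifted source point of `MedialPerturbation`. [folklore] -/
private theorem sPt_two (v : Site 2) : sPt (v, 2) = dartPt v (faceAt v 2) (srcDir v (faceAt v 2)) := by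
  simp [faceAt, cornerOff, srcDir, dartPt, toward, inward, sPt, dS, Site.toComplex, Complex.ext_iff]
  constructor <;> (rw [if_neg (by omega)]; ring)

/-- `sPt` at face index `3` is the shifted source point of `MedialPerturbation`. [folklore] -/
private theorem sPt_three (v : Site 2) : sPt (v, 3) = dartPt v (faceAt v 3) (srcDir v (faceAt v 3)) := by
  simp [faceAt, cornerOff, srcDir, dartPt, toward, inward, sPt, dS, Site.toComplex, Complex.ext_iff, pow_succ, ite_eq_sub_one]
  ring

/-- `tPt` at face index `0` is the shifted target point of `MedialPerturbation`. [folklore] -/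
private theorem tPt_zero (v : Site 2) : tPt (v, 0) = dartPt v (faceAt v 0) (tgtDir v (faceAt v 0)) := by
  simp [faceAt, cornerOff, tgtDir, dartPt, toward, inward, tPt, dT, Site.toComplex, Complex.ext_iff]

/-- `tPt` at face index `1` is the shifted target point of `MedialPerturbation`. [folklore] -/
private theorem tPt_one (v : Site 2) : tPt (v, 1) = dartPt v (faceAt v 1) (tgtDir v (faceAt v 1)) := by
  simp [faceAt, cornerOff, tgtDir, dartPt, toward, inward, tPt, dT, Site.toComplex, Complex.ext_iff, ite_eq_sub_one]
  ring

/-- `tPt` at face index `2` is the shifted target point of `MedialPerturbation`. [folklore] -/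
private theorem tPt_two (v : Site 2) : tPt (v, 2) = dartPt v (faceAt v 2) (tgtDir v (faceAt v 2)) := by
  simp [faceAt, cornerOff, tgtDir, dartPt, toward, inward, tPt, dT, Site.toComplex, Complex.ext_iff]
  constructor <;> (rw [if_neg (by omega)]; ring)

/-- `tPt` at face index `3` is the shifted target point of `MedialPerturbation`. [folklore] -/
private theorem tPt_three (v : Site 2) : tPt (v, 3) = dartPt v (faceAt v 3) (tgtDir v (faceAt v 3)) := by
  simp [faceAt, cornerOff, tgtDir, dartPt, toward, inward, tPt, dT, Site.toComplex, Complex.ext_iff, pow_succ, ite_eq_sub_one]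
  ring

/-- **`sPt` is the shifted source point `dartPt v f (srcDir v f)` of `MedialPerturbation.lean`** (mesh
`1`, face `f = faceAt v k`). [folklore] -/
theorem sPt_eq_dartPt (v : Site 2) (k : Fin 4) : sPt (v, k) = dartPt v (faceAt v k) (srcDir v (faceAt v k)) := by
  fin_cases k
  exacts [sPt_zero v, sPt_one v, sPt_two v, sPt_three v]

/-- **`tPt` is the shifted target point `dartPt v f (tgtDir v f)` of `MedialPerturbation.lean`.**
[folklore] -/
theorem tPt_eq_dartPt (v : Site 2) (k : Fin 4) : tPt (v, k) = dartPt v (faceAt v k) (tgtDir v (faceAt v k)) := by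
  fin_cases k
  exacts [tPt_zero v, tPt_one v, tPt_two v, tPt_three v]

/-- **The vertices of `cyLoop` (`MedialCycleSeparation.lean`) are `sPt`, `tPt` of the orbit**: the
perturbed polygon used here is the closed perturbed polygon of the cycle already in the tree.
[folklore] -/
theorem cyS_eq_sPt (β : Percolation.BondConfig (Site 2)) (q : Site 2 × Fin 4) (m : ℕ) :
    cyS β q m = sPt (cornerOrbit β q m) := by
  rw [cyS, cyV, cyF, cFace, ← sPt_eq_dartPt]

/-- Companion of `cyS_eq_sPt` for the target points. [folklore] -/
theorem cyT_eq_tPt (β : Percolation.BondConfig (Site 2)) (q : Site 2 × Fin 4) (m : ℕ) :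
    cyT β q m = tPt (cornerOrbit β q m) := by
  rw [cyT, cyV, cyF, cFace, ← tPt_eq_dartPt]

/-- **Affine images of segments**: `[c + m A, c + m B] = c + m [A, B]`. [folklore] -/
theorem mem_segment_affine {c m A B z : ℂ} :
    z ∈ segment ℝ (c + m * A) (c + m * B) ↔ ∃ x ∈ segment ℝ A B, z = c + m * x := by
  rw [segment_eq_image', segment_eq_image']
  constructor
  · rintro ⟨θ, hθ, rfl⟩
    refine ⟨A + θ • (B - A), ⟨θ, hθ, rfl⟩, ?_⟩
    simp only [Complex.real_smul]; ring
  · rintro ⟨x, ⟨θ, hθ, rfl⟩, rfl⟩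
    refine ⟨θ, hθ, ?_⟩
    simp only [Complex.real_smul]; ring

/-- **Normalisation.** An equality `v + I^k x = v' + I^{k'} y` of points attached to two corners
becomes `x = u + I^r y` with `u ∈ ℤ²`, `k' = k + r`, `v' = v + I^k u`. [folklore] -/
theorem normalize_corner {v v' : Site 2} {k k' : Fin 4} {x y : ℂ}
    (h : Site.toComplex v + I ^ (k : ℕ) * x = Site.toComplex v' + I ^ (k' : ℕ) * y) :
    ∃ (u : Site 2) (r : Fin 4), x = Site.toComplex u + I ^ (r : ℕ) * y ∧ k' = k + r ∧
      Site.toComplex v' = Site.toComplex v + I ^ (k : ℕ) * Site.toComplex u := by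
  obtain ⟨u, hu⟩ := exists_toComplex_eq_I_pow_mul (v' - v) k
  have hv' : Site.toComplex v' = Site.toComplex v + I ^ (k : ℕ) * Site.toComplex u := by
    rw [← hu, ← Percolation.toComplex_add, add_sub_cancel]
  have hk : I ^ (k' : ℕ) = I ^ (k : ℕ) * I ^ ((k' - k : Fin 4) : ℕ) := by rw [← I_pow_fin_add, add_sub_cancel]
  refine ⟨u, k' - k, ?_, by rw [add_sub_cancel], hv'⟩
  rw [hv', hk] at h
  apply mul_left_cancel₀ (pow_ne_zero _ I_ne_zero)
  linear_combination h

/-- `toComplex ![1, 0] = 1`. [folklore] -/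
theorem toComplex_one_zero : Site.toComplex ![1, 0] = 1 := by apply Complex.ext <;> simp [Site.toComplex]

/-- `toComplex ![0, 1] = I`. [folklore] -/
theorem toComplex_zero_one : Site.toComplex ![0, 1] = I := by apply Complex.ext <;> simp [Site.toComplex]

/-- `toComplex 0 = 0`. [folklore] -/
theorem toComplex_zero_site : Site.toComplex (0 : Site 2) = 0 := by apply Complex.ext <;> simp [Site.toComplex]

section Corners

variable {p p' : Site 2 × Fin 4} {z : ℂ}

/-- The dart piece of `p` is `v + I^k stdD`. [folklore] -/
theorem mem_dart_iff : z ∈ segment ℝ (sPt p) (tPt p) ↔ ∃ x ∈ stdD, z = Site.toComplex p.1 + I ^ (p.2 : ℕ) * x :=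
  mem_segment_affine

/-- The vertex connector of `p` is `v + I^k stdV`. [folklore] -/
theorem mem_vconn_iff : z ∈ segment ℝ (tPt p) (sPt (p.1, p.2 + 1)) ↔ ∃ x ∈ stdV, z = Site.toComplex p.1 + I ^ (p.2 : ℕ) * x := by
  rw [sPt_vertexTurn]; exact mem_segment_affine

/-- The face connector of `p` is `v + I^k stdF`. [folklore] -/
theorem mem_fconn_iff : z ∈ segment ℝ (tPt p) (sPt (p.1 + cornerUnit (p.2 + 1), p.2 + 3)) ↔
    ∃ x ∈ stdF, z = Site.toComplex p.1 + I ^ (p.2 : ℕ) * x := by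
  rw [sPt_faceTurn]; exact mem_segment_affine

/-- From `u = 0`: the vertices agree. [folklore] -/
private theorem fst_eq_of_u_zero {v v' : Site 2} {k : Fin 4} {u : Site 2} (hu : u = 0)
    (hv' : Site.toComplex v' = Site.toComplex v + I ^ (k : ℕ) * Site.toComplex u) : v' = v := by
  rw [hu, toComplex_zero_site, mul_zero, add_zero] at hv'
  exact toComplex_injective_site hv'

/-- **Two dart pieces meet only if they are the same.** [folklore] -/
theorem eq_of_mem_dart_dart (hz : z ∈ segment ℝ (sPt p) (tPt p)) (hz' : z ∈ segment ℝ (sPt p') (tPt p')) : p' = p := by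
  obtain ⟨x, hx, rfl⟩ := mem_dart_iff.1 hz
  obtain ⟨y, hy, h⟩ := mem_dart_iff.1 hz'
  obtain ⟨u, r, hxy, hk, hv⟩ := normalize_corner h
  obtain ⟨hu, hr⟩ := std_DD hx hy hxy
  exact Prod.ext (fst_eq_of_u_zero hu hv) (by rw [hk, hr, add_zero])

/-- **A dart piece and a vertex connector meet only if** the connector starts at the dart's
target point (same corner) or ends at its source point (corner `(v, k+3)`). [folklore] -/
theorem eq_of_mem_dart_vconn (hz : z ∈ segment ℝ (sPt p) (tPt p)) (hz' : z ∈ segment ℝ (tPt p') (sPt (p'.1, p'.2 + 1))) :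
    p' = p ∨ p' = (p.1, p.2 + 3) := by
  obtain ⟨x, hx, rfl⟩ := mem_dart_iff.1 hz
  obtain ⟨y, hy, h⟩ := mem_vconn_iff.1 hz'
  obtain ⟨u, r, hxy, hk, hv⟩ := normalize_corner h
  obtain ⟨hu, hr | hr⟩ := std_DV hx hy hxy
  · exact Or.inl (Prod.ext (fst_eq_of_u_zero hu hv) (by rw [hk, hr, add_zero]))
  · exact Or.inr (Prod.ext (fst_eq_of_u_zero hu hv) (by rw [hk, hr]))

/-- **A dart piece and a face connector meet only if** the connector starts at the dart's target
point (same corner) or ends at its source point (corner `(v + cornerUnit k, k + 1)`). [folklore] -/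
theorem eq_of_mem_dart_fconn (hz : z ∈ segment ℝ (sPt p) (tPt p))
    (hz' : z ∈ segment ℝ (tPt p') (sPt (p'.1 + cornerUnit (p'.2 + 1), p'.2 + 3))) :
    p' = p ∨ p' = (p.1 + cornerUnit p.2, p.2 + 1) := by
  obtain ⟨x, hx, rfl⟩ := mem_dart_iff.1 hz
  obtain ⟨y, hy, h⟩ := mem_fconn_iff.1 hz'
  obtain ⟨u, r, hxy, hk, hv⟩ := normalize_corner h
  rcases std_DF hx hy hxy with ⟨hu, hr⟩ | ⟨hu, hr⟩
  · exact Or.inl (Prod.ext (fst_eq_of_u_zero hu hv) (by rw [hk, hr, add_zero]))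
  · right
    refine Prod.ext ?_ (by rw [hk, hr])
    rw [hu, toComplex_one_zero, mul_one, ← toComplex_cornerUnit, ← Percolation.toComplex_add] at hv
    exact toComplex_injective_site hv

/-- **Two vertex connectors meet only if they are the same.** [folklore] -/
theorem eq_of_mem_vconn_vconn (hz : z ∈ segment ℝ (tPt p) (sPt (p.1, p.2 + 1)))
    (hz' : z ∈ segment ℝ (tPt p') (sPt (p'.1, p'.2 + 1))) : p' = p := by
  obtain ⟨x, hx, rfl⟩ := mem_vconn_iff.1 hz
  obtain ⟨y, hy, h⟩ := mem_vconn_iff.1 hz'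
  obtain ⟨u, r, hxy, hk, hv⟩ := normalize_corner h
  obtain ⟨hu, hr⟩ := std_VV hx hy hxy
  exact Prod.ext (fst_eq_of_u_zero hu hv) (by rw [hk, hr, add_zero])

/-- **Two face connectors meet only if they are the same.** [folklore] -/
theorem eq_of_mem_fconn_fconn (hz : z ∈ segment ℝ (tPt p) (sPt (p.1 + cornerUnit (p.2 + 1), p.2 + 3)))
    (hz' : z ∈ segment ℝ (tPt p') (sPt (p'.1 + cornerUnit (p'.2 + 1), p'.2 + 3))) : p' = p := by
  obtain ⟨x, hx, rfl⟩ := mem_fconn_iff.1 hz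
  obtain ⟨y, hy, h⟩ := mem_fconn_iff.1 hz'
  obtain ⟨u, r, hxy, hk, hv⟩ := normalize_corner h
  obtain ⟨hu, hr⟩ := std_FF hx hy hxy
  exact Prod.ext (fst_eq_of_u_zero hu hv) (by rw [hk, hr, add_zero])

/-- **A vertex connector and a face connector meet only if** they start at the same point (same
corner) or end at the same point (the face connector comes from `(v + cornerUnit (k+1), k+2)`);
in both cases the two corners have the *same target edge*, so a single configuration never
produces both connectors. [folklore] -/
theorem eq_of_mem_vconn_fconn (hz : z ∈ segment ℝ (tPt p) (sPt (p.1, p.2 + 1)))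
    (hz' : z ∈ segment ℝ (tPt p') (sPt (p'.1 + cornerUnit (p'.2 + 1), p'.2 + 3))) :
    p' = p ∨ p' = (p.1 + cornerUnit (p.2 + 1), p.2 + 2) := by
  obtain ⟨x, hx, rfl⟩ := mem_vconn_iff.1 hz
  obtain ⟨y, hy, h⟩ := mem_fconn_iff.1 hz'
  obtain ⟨u, r, hxy, hk, hv⟩ := normalize_corner h
  rcases std_VF hx hy hxy with ⟨hu, hr⟩ | ⟨hu, hr⟩
  · exact Or.inl (Prod.ext (fst_eq_of_u_zero hu hv) (by rw [hk, hr, add_zero]))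
  · right
    refine Prod.ext ?_ (by rw [hk, hr])
    rw [hu, toComplex_zero_one, ← toComplex_cornerUnit_succ, ← Percolation.toComplex_add] at hv
    exact toComplex_injective_site hv

/-- The two corners of the second case of `eq_of_mem_vconn_fconn` have the same target edge.
[folklore] -/
theorem cTgt_of_vconn_fconn (p : Site 2 × Fin 4) : cTgt (p.1 + cornerUnit (p.2 + 1), p.2 + 2) = cTgt p := by
  rw [cTgt, cTgt]
  simp only
  rw [fin4_add_two_add_one, show p.2 + 3 = p.2 + 1 + 2 from (fin4_add_one_add_two p.2).symm, cornerUnit_add_two,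
    ← sub_eq_add_neg, add_sub_cancel_right, Sym2.eq_swap]

end Corners

/-! ### Consecutive pieces meet only at their common endpoint -/

/-- Two complex numbers with nonzero "cross product" `Im (u w̄)` are `ℝ`-linearly independent.
[folklore] -/
theorem linearIndependent_of_im_mul_conj_ne_zero {u w : ℂ} (h : (u * (starRingEnd ℂ) w).im ≠ 0) :
    LinearIndependent ℝ ![u, w] := by
  refine LinearIndependent.pair_iff.2 fun s t hst => ?_
  have k1 := congrArg (fun z => (z * (starRingEnd ℂ) w).im) hst
  have k2 := congrArg (fun z => (z * (starRingEnd ℂ) u).im) hst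
  have hwu : (w * (starRingEnd ℂ) u).im = -(u * (starRingEnd ℂ) w).im := by
    rw [show w * (starRingEnd ℂ) u = (starRingEnd ℂ) (u * (starRingEnd ℂ) w) by simp [map_mul, mul_comm], Complex.conj_im]
  simp only [add_mul, Complex.add_im, Complex.real_smul, mul_assoc, Complex.im_ofReal_mul, Complex.mul_conj,
    Complex.ofReal_im, mul_zero, add_zero, zero_add, Complex.zero_im, zero_mul, hwu] at k1 k2
  exact ⟨(mul_eq_zero.1 k1).resolve_right h, (mul_eq_zero.1 k2).resolve_right (neg_ne_zero.2 h)⟩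

/-- **Two segments with a common endpoint and independent directions meet only there** (Mathlib's
`segment_inter_subset_endpoint_of_linearIndependent_sub`, with independence read off the complex
cross product). [folklore] -/
theorem segment_inter_segment_subset {a b c : ℂ} (h : ((b - a) * (starRingEnd ℂ) (c - b)).im ≠ 0) :
    segment ℝ a b ∩ segment ℝ b c ⊆ {b} := by
  rw [segment_symm ℝ a b]
  apply segment_inter_subset_endpoint_of_linearIndependent_sub ℝ
  apply linearIndependent_of_im_mul_conj_ne_zero
  rwa [show a - b = -(b - a) by ring, neg_mul, Complex.neg_im, neg_ne_zero]

/-- Cross products are insensitive to a common rotation. [folklore] -/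
theorem im_mul_conj_mul (m A B : ℂ) : ((m * A) * (starRingEnd ℂ) (m * B)).im = Complex.normSq m * (A * (starRingEnd ℂ) B).im := by
  rw [map_mul, show m * A * ((starRingEnd ℂ) m * (starRingEnd ℂ) B) = (m * (starRingEnd ℂ) m) * (A * (starRingEnd ℂ) B) by ring,
    Complex.mul_conj, Complex.im_ofReal_mul]

/-- `normSq (I^k) = 1`. [folklore] -/
theorem normSq_I_pow (n : ℕ) : Complex.normSq (I ^ n) = 1 := by
  rw [map_pow, Complex.normSq_I, one_pow]

section Adjacent

variable {β : Percolation.BondConfig (Site 2)}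

/-- **The dart piece and the following connector meet only at the target point.** [folklore] -/
theorem dart_inter_conn_subset (p : Site 2 × Fin 4) :
    segment ℝ (sPt p) (tPt p) ∩ segment ℝ (tPt p) (sPt (nextCorner β p)) ⊆ {tPt p} := by
  apply segment_inter_segment_subset
  by_cases h : cTgt p ∈ β
  · rw [sPt_nextCorner_of_mem h, tPt, sPt, show Site.toComplex p.1 + I ^ (p.2 : ℕ) * dT - (Site.toComplex p.1 + I ^ (p.2 : ℕ) * dS) =
      I ^ (p.2 : ℕ) * (dT - dS) by ring, show Site.toComplex p.1 + I ^ (p.2 : ℕ) * fE - (Site.toComplex p.1 + I ^ (p.2 : ℕ) * dT) =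
      I ^ (p.2 : ℕ) * (fE - dT) by ring, im_mul_conj_mul, normSq_I_pow, one_mul]
    norm_num [Complex.mul_im, Complex.sub_re, Complex.sub_im, Complex.conj_re, Complex.conj_im]
  · rw [sPt_nextCorner_of_not_mem h, tPt, sPt, show Site.toComplex p.1 + I ^ (p.2 : ℕ) * dT - (Site.toComplex p.1 + I ^ (p.2 : ℕ) * dS) =
      I ^ (p.2 : ℕ) * (dT - dS) by ring, show Site.toComplex p.1 + I ^ (p.2 : ℕ) * vE - (Site.toComplex p.1 + I ^ (p.2 : ℕ) * dT) =
      I ^ (p.2 : ℕ) * (vE - dT) by ring, im_mul_conj_mul, normSq_I_pow, one_mul]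
    norm_num [Complex.mul_im, Complex.sub_re, Complex.sub_im, Complex.conj_re, Complex.conj_im]

/-- **The connector and the next dart piece meet only at the next source point.** [folklore] -/
theorem conn_inter_dart_subset (p : Site 2 × Fin 4) :
    segment ℝ (tPt p) (sPt (nextCorner β p)) ∩ segment ℝ (sPt (nextCorner β p)) (tPt (nextCorner β p)) ⊆ {sPt (nextCorner β p)} := by
  apply segment_inter_segment_subset
  by_cases h : cTgt p ∈ β
  · have e1 : sPt (nextCorner β p) - tPt p = I ^ (p.2 : ℕ) * (fE - dT) := by rw [sPt_nextCorner_of_mem h, tPt]; ring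
    have e2 : tPt (nextCorner β p) - sPt (nextCorner β p) = I ^ (p.2 : ℕ) * (I ^ 3 * (dT - dS)) := by
      rw [tPt, sPt, nextCorner_of_mem h]
      simp only
      rw [I_pow_fin_add, show ((3 : Fin 4) : ℕ) = 3 from rfl]; ring
    rw [e1, e2, im_mul_conj_mul, normSq_I_pow, one_mul]
    norm_num [pow_succ, Complex.mul_im, Complex.mul_re, Complex.sub_re, Complex.sub_im, Complex.conj_re, Complex.conj_im]
  · have e1 : sPt (nextCorner β p) - tPt p = I ^ (p.2 : ℕ) * (vE - dT) := by rw [sPt_nextCorner_of_not_mem h, tPt]; ring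
    have e2 : tPt (nextCorner β p) - sPt (nextCorner β p) = I ^ (p.2 : ℕ) * (I * (dT - dS)) := by
      rw [tPt, sPt, nextCorner_of_not_mem h]
      simp only
      rw [I_pow_fin_succ]; ring
    rw [e1, e2, im_mul_conj_mul, normSq_I_pow, one_mul]
    norm_num [Complex.mul_im, Complex.mul_re, Complex.sub_re, Complex.sub_im, Complex.conj_re, Complex.conj_im]

end Adjacent

/-! ### Exterior angles: each turn contributes `(π/2) · turnSign` -/

/-- `arg (1 + I) = π / 4`. [folklore] -/
theorem arg_one_add_I : arg (1 + I) = Real.pi / 4 := by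
  have h2 : (Real.sqrt 2 : ℂ) * (Real.sqrt 2 : ℂ) = 2 := by
    rw [← Complex.ofReal_mul, Real.mul_self_sqrt (by norm_num)]; norm_num
  have h : (1 : ℂ) + I = (Real.sqrt 2 : ℝ) * (Complex.cos (Real.pi / 4 : ℝ) + Complex.sin (Real.pi / 4 : ℝ) * I) := by
    rw [← Complex.ofReal_cos, ← Complex.ofReal_sin, Real.cos_pi_div_four, Real.sin_pi_div_four]
    push_cast
    linear_combination (-(1 + I) / 2) * h2
  rw [h, Complex.arg_mul_cos_add_sin_mul_I (Real.sqrt_pos.2 (by norm_num)) ⟨by linarith [Real.pi_pos], by linarith [Real.pi_pos]⟩]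

/-- `arg (1 - I) = -(π / 4)`. [folklore] -/
theorem arg_one_sub_I : arg (1 - I) = -(Real.pi / 4) := by
  have : (1 : ℂ) - I = (starRingEnd ℂ) (1 + I) := by simp [map_add, sub_eq_add_neg]
  rw [this, Complex.arg_conj, arg_one_add_I, if_neg]
  linarith [Real.pi_pos]

/-- `arg ((1 + I) / 2) = π / 4`. [folklore] -/
theorem arg_one_add_I_div_two : arg ((1 + I) / 2) = Real.pi / 4 := by
  rw [show (1 + I) / 2 = ((1 / 2 : ℝ) : ℂ) * (1 + I) by push_cast; ring, Complex.arg_real_mul _ (by norm_num), arg_one_add_I]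

/-- `arg ((1 - I) / 2) = -(π / 4)`. [folklore] -/
theorem arg_one_sub_I_div_two : arg ((1 - I) / 2) = -(Real.pi / 4) := by
  rw [show (1 - I) / 2 = ((1 / 2 : ℝ) : ℂ) * (1 - I) by push_cast; ring, Complex.arg_real_mul _ (by norm_num), arg_one_sub_I]

section Angles

variable {β : Percolation.BondConfig (Site 2)}

/-- **The angle at the target point** (between the dart piece and the connector): `π/4` at a
vertex turn, `-π/4` at a face turn. [folklore] -/
theorem arg_at_tPt (p : Site 2 × Fin 4) :
    arg ((sPt (nextCorner β p) - tPt p) / (tPt p - sPt p)) = Real.pi / 4 * turnSign β p := by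
  classical
  have hd : tPt p - sPt p = I ^ (p.2 : ℕ) * (dT - dS) := by rw [tPt, sPt]; ring
  have hne : dT - dS ≠ 0 := by intro h0; have := congrArg Complex.im h0; norm_num at this
  unfold turnSign
  by_cases h : cTgt p ∈ β
  · rw [if_pos h, hd, sPt_nextCorner_of_mem h, tPt, show Site.toComplex p.1 + I ^ (p.2 : ℕ) * fE - (Site.toComplex p.1 + I ^ (p.2 : ℕ) * dT) =
      I ^ (p.2 : ℕ) * (fE - dT) by ring, mul_div_mul_left _ _ (pow_ne_zero _ I_ne_zero)]
    have : (fE - dT) / (dT - dS) = (1 - I) / 2 := by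
      rw [div_eq_iff hne]; apply Complex.ext <;> norm_num
    rw [this, arg_one_sub_I_div_two]; push_cast; ring
  · rw [if_neg h, hd, sPt_nextCorner_of_not_mem h, tPt, show Site.toComplex p.1 + I ^ (p.2 : ℕ) * vE - (Site.toComplex p.1 + I ^ (p.2 : ℕ) * dT) =
      I ^ (p.2 : ℕ) * (vE - dT) by ring, mul_div_mul_left _ _ (pow_ne_zero _ I_ne_zero)]
    have : (vE - dT) / (dT - dS) = (1 + I) / 2 := by
      rw [div_eq_iff hne]; apply Complex.ext <;> norm_num
    rw [this, arg_one_add_I_div_two]; push_cast; ring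

/-- **The angle at the next source point** (between the connector and the next dart piece):
`π/4` at a vertex turn, `-π/4` at a face turn. [folklore] -/
theorem arg_at_sPt (p : Site 2 × Fin 4) :
    arg ((tPt (nextCorner β p) - sPt (nextCorner β p)) / (sPt (nextCorner β p) - tPt p)) = Real.pi / 4 * turnSign β p := by
  classical
  unfold turnSign
  by_cases h : cTgt p ∈ β
  · have e1 : sPt (nextCorner β p) - tPt p = I ^ (p.2 : ℕ) * (fE - dT) := by rw [sPt_nextCorner_of_mem h, tPt]; ring
    have e2 : tPt (nextCorner β p) - sPt (nextCorner β p) = I ^ (p.2 : ℕ) * (I ^ 3 * (dT - dS)) := by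
      rw [tPt, sPt, nextCorner_of_mem h]
      simp only
      rw [I_pow_fin_add, show ((3 : Fin 4) : ℕ) = 3 from rfl]; ring
    have hne : fE - dT ≠ 0 := by intro h0; have := congrArg Complex.im h0; norm_num at this
    rw [if_pos h, e1, e2, mul_div_mul_left _ _ (pow_ne_zero _ I_ne_zero)]
    have : I ^ 3 * (dT - dS) / (fE - dT) = 1 - I := by
      rw [div_eq_iff hne]; apply Complex.ext <;> norm_num [pow_succ]
    rw [this, arg_one_sub_I]; push_cast; ring
  · have e1 : sPt (nextCorner β p) - tPt p = I ^ (p.2 : ℕ) * (vE - dT) := by rw [sPt_nextCorner_of_not_mem h, tPt]; ring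
    have e2 : tPt (nextCorner β p) - sPt (nextCorner β p) = I ^ (p.2 : ℕ) * (I * (dT - dS)) := by
      rw [tPt, sPt, nextCorner_of_not_mem h]
      simp only
      rw [I_pow_fin_succ]; ring
    have hne : vE - dT ≠ 0 := by intro h0; have := congrArg Complex.re h0; norm_num at this
    rw [if_neg h, e1, e2, mul_div_mul_left _ _ (pow_ne_zero _ I_ne_zero)]
    have : I * (dT - dS) / (vE - dT) = 1 + I := by
      rw [div_eq_iff hne]; apply Complex.ext <;> norm_num
    rw [this, arg_one_add_I]; push_cast; ring

end Angles

/-! ### The perturbed polygon of a cycle -/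

section Polygon

variable (β : Percolation.BondConfig (Site 2)) (q : Site 2 × Fin 4)

local notation "orb" => cornerOrbit β q

/-- The `j`-th vertex of the perturbed polygon of the orbit of `q`: `sPt (orb (j/2))` for even
`j`, `tPt (orb (j/2))` for odd `j` — source point, target point, source point, …. [folklore] -/
def pieceVert (j : ℕ) : ℂ := if j % 2 = 0 then sPt (orb (j / 2)) else tPt (orb (j / 2))

/-- The vertices of the perturbed polygon of a cycle of period `Q`, as a `2Q`-periodic sequence
indexed by `ℤ` (the input format of `IsSimplePolygon`). [folklore] -/
def cycVert (Q : ℕ) (i : ℤ) : ℂ := pieceVert β q (i % ((2 * Q : ℕ) : ℤ)).toNat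

variable {β q}

/-- Even vertices are source points. [folklore] -/
theorem pieceVert_even (m : ℕ) : pieceVert β q (2 * m) = sPt (orb m) := by
  unfold pieceVert; rw [if_pos (by omega), show 2 * m / 2 = m by omega]

/-- Odd vertices are target points. [folklore] -/
theorem pieceVert_odd (m : ℕ) : pieceVert β q (2 * m + 1) = tPt (orb m) := by
  unfold pieceVert; rw [if_neg (by omega), show (2 * m + 1) / 2 = m by omega]

/-- The vertex after an odd vertex is the source point of the next corner. [folklore] -/
theorem pieceVert_odd_succ (m : ℕ) : pieceVert β q (2 * m + 2) = sPt (nextCorner β (orb m)) := by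
  rw [show 2 * m + 2 = 2 * (m + 1) by ring, pieceVert_even]; rfl

/-- The vertex two after an odd vertex is the target point of the next corner. [folklore] -/
theorem pieceVert_odd_succ_succ (m : ℕ) : pieceVert β q (2 * m + 3) = tPt (nextCorner β (orb m)) := by
  rw [show 2 * m + 3 = 2 * (m + 1) + 1 by ring, pieceVert_odd]; rfl

/-- Periodicity of the vertices for a cycle of period `Q`. [folklore] -/
theorem pieceVert_add_period {Q : ℕ} (hP : orb Q = q) (j : ℕ) : pieceVert β q (j + 2 * Q) = pieceVert β q j := by
  unfold pieceVert
  rw [show (j + 2 * Q) % 2 = j % 2 by omega, show (j + 2 * Q) / 2 = j / 2 + Q by omega, cornerOrbit_add_period hP]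

/-- Periodicity under multiples of the period. [folklore] -/
theorem pieceVert_add_mul_period {Q : ℕ} (hP : orb Q = q) (j t : ℕ) : pieceVert β q (j + 2 * Q * t) = pieceVert β q j := by
  induction t with
  | zero => simp
  | succ t ih => rw [Nat.mul_succ, ← add_assoc, pieceVert_add_period hP, ih]

/-- Reduction of the index modulo `2Q`. [folklore] -/
theorem pieceVert_mod {Q : ℕ} (hP : orb Q = q) (j : ℕ) : pieceVert β q (j % (2 * Q)) = pieceVert β q j := by
  conv_rhs => rw [← Nat.mod_add_div j (2 * Q)]
  exact (pieceVert_add_mul_period hP _ _).symm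

/-- The `ℤ`-indexed vertices on natural indices. [folklore] -/
theorem cycVert_natCast {Q : ℕ} (hP : orb Q = q) (j : ℕ) : cycVert β q Q j = pieceVert β q j := by
  unfold cycVert; rw [← Int.natCast_mod, Int.toNat_natCast, pieceVert_mod hP]

/-- The `ℤ`-indexed vertices are `2Q`-periodic. [folklore] -/
theorem cycVert_add_period (Q : ℕ) (i : ℤ) : cycVert β q Q (i + ((2 * Q : ℕ) : ℤ)) = cycVert β q Q i := by
  unfold cycVert; rw [Int.add_emod_right]

/-- **Consecutive vertices are distinct.** [folklore] -/
theorem pieceVert_succ_ne (j : ℕ) : pieceVert β q (j + 1) ≠ pieceVert β q j := by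
  obtain ⟨m, rfl | rfl⟩ := Nat.even_or_odd' j
  · rw [pieceVert_odd, pieceVert_even, tPt, sPt]
    intro h
    have : I ^ ((orb m).2 : ℕ) * (dT - dS) = 0 := by linear_combination h
    rcases mul_eq_zero.1 this with h0 | h0
    · exact pow_ne_zero _ I_ne_zero h0
    · have := congrArg Complex.im h0; norm_num at this
  · rw [show 2 * m + 1 + 1 = 2 * m + 2 by ring, pieceVert_odd_succ, pieceVert_odd]
    intro h
    by_cases hc : cTgt (orb m) ∈ β
    · rw [sPt_nextCorner_of_mem hc, tPt] at h
      have : I ^ ((orb m).2 : ℕ) * (fE - dT) = 0 := by linear_combination h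
      rcases mul_eq_zero.1 this with h0 | h0
      · exact pow_ne_zero _ I_ne_zero h0
      · have := congrArg Complex.im h0; norm_num at this
    · rw [sPt_nextCorner_of_not_mem hc, tPt] at h
      have : I ^ ((orb m).2 : ℕ) * (vE - dT) = 0 := by linear_combination h
      rcases mul_eq_zero.1 this with h0 | h0
      · exact pow_ne_zero _ I_ne_zero h0
      · have := congrArg Complex.re h0; norm_num at this

/-- **Consecutive pieces meet only at the common vertex.** [folklore] -/
theorem pieceVert_adjacent (b : ℕ) :
    segment ℝ (pieceVert β q b) (pieceVert β q (b + 1)) ∩ segment ℝ (pieceVert β q (b + 1)) (pieceVert β q (b + 2)) ⊆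
      {pieceVert β q (b + 1)} := by
  obtain ⟨m, rfl | rfl⟩ := Nat.even_or_odd' b
  · rw [pieceVert_even, pieceVert_odd, pieceVert_odd_succ]
    exact dart_inter_conn_subset _
  · rw [show 2 * m + 1 + 1 = 2 * m + 2 by ring, show 2 * m + 1 + 2 = 2 * m + 3 by ring, pieceVert_odd, pieceVert_odd_succ,
      pieceVert_odd_succ_succ]
    exact conn_inter_dart_subset _

/-- **A dart piece and a connector meet only if** the connector leaves from or leads into the
dart. [folklore] -/
theorem orb_eq_of_mem_dart_conn {m m' : ℕ} {z : ℂ} (hz : z ∈ segment ℝ (sPt (orb m)) (tPt (orb m)))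
    (hz' : z ∈ segment ℝ (tPt (orb m')) (sPt (orb (m' + 1)))) : orb m' = orb m ∨ orb (m' + 1) = orb m := by
  have hsucc : orb (m' + 1) = nextCorner β (orb m') := rfl
  rw [hsucc] at hz' ⊢
  by_cases hc : cTgt (orb m') ∈ β
  · rw [nextCorner_of_mem hc] at hz' ⊢
    rcases eq_of_mem_dart_fconn hz hz' with h | h
    · exact Or.inl h
    · right
      rw [h]
      refine Prod.ext ?_ (fin4_add_one_add_three _)
      show (orb m).1 + cornerUnit (orb m).2 + cornerUnit ((orb m).2 + 1 + 1) = (orb m).1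
      rw [fin4_add_one_add_one, cornerUnit_add_two]; abel
  · rw [nextCorner_of_not_mem hc] at hz' ⊢
    rcases eq_of_mem_dart_vconn hz hz' with h | h
    · exact Or.inl h
    · right
      rw [h]
      exact Prod.ext rfl (fin4_add_three_add_one _)

/-- **Two connectors meet only if they are the same.** [folklore] -/
theorem orb_eq_of_mem_conn_conn {m m' : ℕ} {z : ℂ} (hz : z ∈ segment ℝ (tPt (orb m)) (sPt (orb (m + 1))))
    (hz' : z ∈ segment ℝ (tPt (orb m')) (sPt (orb (m' + 1)))) : orb m' = orb m := by
  have hsucc : ∀ n, orb (n + 1) = nextCorner β (orb n) := fun n => rfl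
  rw [hsucc] at hz hz'
  by_cases hc : cTgt (orb m) ∈ β <;> by_cases hc' : cTgt (orb m') ∈ β
  · rw [nextCorner_of_mem hc] at hz; rw [nextCorner_of_mem hc'] at hz'
    exact eq_of_mem_fconn_fconn hz hz'
  · rw [nextCorner_of_mem hc] at hz; rw [nextCorner_of_not_mem hc'] at hz'
    rcases eq_of_mem_vconn_fconn hz' hz with h | h
    · rw [h] at hc; exact absurd hc hc'
    · rw [h, cTgt_of_vconn_fconn] at hc; exact absurd hc hc'
  · rw [nextCorner_of_not_mem hc] at hz; rw [nextCorner_of_mem hc'] at hz'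
    rcases eq_of_mem_vconn_fconn hz hz' with h | h
    · rw [h] at hc'; exact absurd hc' hc
    · rw [h, cTgt_of_vconn_fconn] at hc'; exact absurd hc' hc
  · rw [nextCorner_of_not_mem hc] at hz; rw [nextCorner_of_not_mem hc'] at hz'
    exact eq_of_mem_vconn_vconn hz hz'

variable {Q : ℕ}

/-- Injectivity of a cycle of minimal period `Q` on `[0, Q)`. [folklore] -/
theorem orb_injOn (hmin : ∀ s, 0 < s → s < Q → orb s ≠ q) {m m' : ℕ} (hm : m < Q) (hm' : m' < Q)
    (h : orb m = orb m') : m = m' := by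
  by_contra hne
  wlog hlt : m < m' generalizing m m'
  · exact this hm' hm h.symm (Ne.symm hne) (lt_of_le_of_ne (not_lt.1 hlt) (Ne.symm hne))
  have key : orb 0 = orb (m' - m) :=
    cornerOrbit_eq_of_add_eq q m (by rw [zero_add, Nat.sub_add_cancel hlt.le]; exact h)
  exact hmin (m' - m) (by omega) (by omega) key.symm

/-- On a cycle of minimal period `Q`, `orb (m' + 1) = orb m` pins `m` down as `(m' + 1) % Q`.
[folklore] -/
theorem mod_eq_of_orb_succ_eq (hQ : 0 < Q) (hP : orb Q = q) (hmin : ∀ s, 0 < s → s < Q → orb s ≠ q) {m m' : ℕ}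
    (hm : m < Q) (h : orb (m' + 1) = orb m) : (m' + 1) % Q = m :=
  orb_injOn hmin (Nat.mod_lt _ hQ) hm ((cornerOrbit_mod_period hP _).trans h)

/-- **Non-adjacent pieces of the polygon are disjoint** (for a cycle of minimal period `Q`).
[folklore] -/
theorem pieceVert_disjoint (hQ : 0 < Q) (hP : orb Q = q) (hmin : ∀ s, 0 < s → s < Q → orb s ≠ q) {a b : ℕ}
    (ha : a < 2 * Q) (hb : b < 2 * Q) (h0 : b ≠ a) (h1 : b ≠ (a + 1) % (2 * Q)) (h2 : a ≠ (b + 1) % (2 * Q)) :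
    Disjoint (segment ℝ (pieceVert β q a) (pieceVert β q (a + 1))) (segment ℝ (pieceVert β q b) (pieceVert β q (b + 1))) := by
  rw [Set.disjoint_left]
  intro z hz hz'
  have hmod2 : ∀ n, (2 * n + 2) % (2 * Q) = 2 * ((n + 1) % Q) := fun n => by
    rw [show 2 * n + 2 = 2 * (n + 1) by ring, Nat.mul_mod_mul_left]
  obtain ⟨m, rfl | rfl⟩ := Nat.even_or_odd' a <;> obtain ⟨m', rfl | rfl⟩ := Nat.even_or_odd' b
  · -- dart / dart
    rw [pieceVert_even, pieceVert_odd] at hz hz'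
    have := orb_injOn hmin (by omega) (by omega) (eq_of_mem_dart_dart hz hz')
    omega
  · -- dart / connector
    rw [pieceVert_even, pieceVert_odd] at hz
    rw [pieceVert_odd, show 2 * m' + 1 + 1 = 2 * (m' + 1) by ring, pieceVert_even] at hz'
    rcases orb_eq_of_mem_dart_conn hz hz' with h | h
    · have := orb_injOn hmin (by omega) (by omega) h
      apply h1; rw [Nat.mod_eq_of_lt (by omega)]; omega
    · have := mod_eq_of_orb_succ_eq hQ hP hmin (by omega) h
      apply h2; rw [show 2 * m' + 1 + 1 = 2 * m' + 2 by ring, hmod2]; omega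
  · -- connector / dart
    rw [pieceVert_odd, show 2 * m + 1 + 1 = 2 * (m + 1) by ring, pieceVert_even] at hz
    rw [pieceVert_even, pieceVert_odd] at hz'
    rcases orb_eq_of_mem_dart_conn hz' hz with h | h
    · have := orb_injOn hmin (by omega) (by omega) h
      apply h2; rw [Nat.mod_eq_of_lt (by omega)]; omega
    · have := mod_eq_of_orb_succ_eq hQ hP hmin (by omega) h
      apply h1; rw [show 2 * m + 1 + 1 = 2 * m + 2 by ring, hmod2]; omega
  · -- connector / connector
    rw [pieceVert_odd, show 2 * m + 1 + 1 = 2 * (m + 1) by ring, pieceVert_even] at hz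
    rw [pieceVert_odd, show 2 * m' + 1 + 1 = 2 * (m' + 1) by ring, pieceVert_even] at hz'
    have := orb_injOn hmin (by omega) (by omega) (orb_eq_of_mem_conn_conn hz hz')
    omega

/-- **The perturbed polygon of a cycle of minimal period `Q ≥ 2` is a simple closed polygon.**
[folklore] -/
theorem isSimplePolygon_cycVert (hQ : 2 ≤ Q) (hP : orb Q = q) (hmin : ∀ s, 0 < s → s < Q → orb s ≠ q) :
    IsSimplePolygon (cycVert β q Q) (2 * Q) := by
  have hQ0 : 0 < Q := by omega
  refine IsSimplePolygon.of_Ico (by omega) (cycVert_add_period Q) (fun i hi0 hi => ?_) (fun i j hi0 hi hj0 hj h0 h1 h2 => ?_)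
    (fun i hi0 hi => ?_)
  · obtain ⟨a, rfl⟩ := Int.eq_ofNat_of_zero_le hi0
    rw [show (a : ℤ) + 1 = ((a + 1 : ℕ) : ℤ) by push_cast; ring, cycVert_natCast hP, cycVert_natCast hP]
    exact pieceVert_succ_ne a
  · obtain ⟨a, rfl⟩ := Int.eq_ofNat_of_zero_le hi0
    obtain ⟨b, rfl⟩ := Int.eq_ofNat_of_zero_le hj0
    rw [show (a : ℤ) + 1 = ((a + 1 : ℕ) : ℤ) by push_cast; ring, show (b : ℤ) + 1 = ((b + 1 : ℕ) : ℤ) by push_cast; ring,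
      cycVert_natCast hP, cycVert_natCast hP, cycVert_natCast hP, cycVert_natCast hP]
    have ha : a < 2 * Q := by exact_mod_cast hi
    have hb : b < 2 * Q := by exact_mod_cast hj
    refine pieceVert_disjoint hQ0 hP hmin ha hb (fun h => h0 (by rw [h])) (fun h => h1 ?_) (fun h => h2 ?_)
    · rw [show (a : ℤ) + 1 = ((a + 1 : ℕ) : ℤ) by push_cast; ring, ← Int.natCast_mod]; exact_mod_cast h
    · rw [show (b : ℤ) + 1 = ((b + 1 : ℕ) : ℤ) by push_cast; ring, ← Int.natCast_mod]; exact_mod_cast h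
  · obtain ⟨a, rfl⟩ := Int.eq_ofNat_of_zero_le hi0
    have e0 : cycVert β q Q ((a : ℤ) - 1) = pieceVert β q (a + 2 * Q - 1) := by
      rw [← cycVert_add_period Q, show (a : ℤ) - 1 + ((2 * Q : ℕ) : ℤ) = ((a + 2 * Q - 1 : ℕ) : ℤ) by omega, cycVert_natCast hP]
    have e1 : cycVert β q Q (a : ℤ) = pieceVert β q (a + 2 * Q - 1 + 1) := by
      rw [cycVert_natCast hP, show a + 2 * Q - 1 + 1 = a + 2 * Q by omega, pieceVert_add_period hP]
    have e2 : cycVert β q Q ((a : ℤ) + 1) = pieceVert β q (a + 2 * Q - 1 + 2) := by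
      rw [show (a : ℤ) + 1 = ((a + 1 : ℕ) : ℤ) by push_cast; ring, cycVert_natCast hP,
        show a + 2 * Q - 1 + 2 = a + 1 + 2 * Q by omega, pieceVert_add_period hP]
    rw [e0, e1, e2]
    exact pieceVert_adjacent _

/-! ### The total turning -/

/-- Exterior angles of a periodic polygon are periodic. [folklore] -/
theorem extAngle_add_period {z : ℤ → ℂ} {n : ℕ} (hz : ∀ i, z (i + n) = z i) (i : ℤ) : extAngle z (i + n) = extAngle z i := by
  simp only [extAngle]
  rw [show i + n + 1 = i + 1 + n by ring, show i + n - 1 = i - 1 + n by ring, hz, hz, hz]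

/-- A sum over `range (2Q)` as a sum of consecutive pairs. [folklore] -/
theorem sum_range_two_mul (g : ℕ → ℝ) (Q : ℕ) :
    ∑ i ∈ Finset.range (2 * Q), g i = ∑ m ∈ Finset.range Q, (g (2 * m) + g (2 * m + 1)) := by
  induction Q with
  | zero => simp
  | succ Q ih => rw [Nat.mul_succ, Finset.sum_range_succ, Finset.sum_range_succ, ih, Finset.sum_range_succ]; ring

/-- **The exterior angles at the two ends of the `m`-th connector add up to `(π/2) · turnSign`.**
[folklore] -/
theorem extAngle_pair (hP : orb Q = q) (m : ℕ) :
    extAngle (cycVert β q Q) ((2 * m : ℕ) + 1) + extAngle (cycVert β q Q) ((2 * m + 1 : ℕ) + 1) =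
      Real.pi / 2 * turnSign β (orb m) := by
  have e1 : extAngle (cycVert β q Q) ((2 * m : ℕ) + 1) = Real.pi / 4 * turnSign β (orb m) := by
    rw [extAngle, show ((2 * m : ℕ) : ℤ) + 1 + 1 = ((2 * m + 2 : ℕ) : ℤ) by push_cast; ring,
      show ((2 * m : ℕ) : ℤ) + 1 - 1 = ((2 * m : ℕ) : ℤ) by ring, show ((2 * m : ℕ) : ℤ) + 1 = ((2 * m + 1 : ℕ) : ℤ) by push_cast; ring,
      cycVert_natCast hP, cycVert_natCast hP, cycVert_natCast hP, pieceVert_odd_succ, pieceVert_odd, pieceVert_even]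
    exact arg_at_tPt _
  have e2 : extAngle (cycVert β q Q) ((2 * m + 1 : ℕ) + 1) = Real.pi / 4 * turnSign β (orb m) := by
    rw [extAngle, show ((2 * m + 1 : ℕ) : ℤ) + 1 + 1 = ((2 * m + 3 : ℕ) : ℤ) by push_cast; ring,
      show ((2 * m + 1 : ℕ) : ℤ) + 1 - 1 = ((2 * m + 1 : ℕ) : ℤ) by ring,
      show ((2 * m + 1 : ℕ) : ℤ) + 1 = ((2 * m + 2 : ℕ) : ℤ) by push_cast; ring,
      cycVert_natCast hP, cycVert_natCast hP, cycVert_natCast hP, pieceVert_odd_succ_succ, pieceVert_odd_succ, pieceVert_odd]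
    exact arg_at_sPt _
  rw [e1, e2]; ring

/-- **The total turning of the perturbed polygon is `(π/2) ∑ turnSign`.** [folklore] -/
theorem sum_extAngle_cycVert (hP : orb Q = q) :
    ∑ i ∈ Finset.range (2 * Q), extAngle (cycVert β q Q) i = Real.pi / 2 * ∑ m ∈ Finset.range Q, (turnSign β (orb m) : ℝ) := by
  have hper : ∀ i, extAngle (cycVert β q Q) (i + ((2 * Q : ℕ) : ℤ)) = extAngle (cycVert β q Q) i :=
    extAngle_add_period (cycVert_add_period Q)
  rw [← sum_range_shift_of_periodic hper 1, Nat.cast_one,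
    sum_range_two_mul (fun i : ℕ => extAngle (cycVert β q Q) ((i : ℤ) + 1)) Q, Finset.mul_sum]
  exact Finset.sum_congr rfl fun m _ => extAngle_pair hP m

end Polygon

/-! ### T2 by the polygonal route -/

/-- A corner is never its own successor. [cite: Smirnov2001, §2] -/
theorem nextCorner_ne_self (β : Percolation.BondConfig (Site 2)) (p : Site 2 × Fin 4) : nextCorner β p ≠ p := by
  by_cases h : cTgt p ∈ β
  · rw [nextCorner_of_mem h]
    intro he
    exact fin4_add_three_ne p.2 (congrArg Prod.snd he)
  · rw [nextCorner_of_not_mem h]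
    intro he
    have : p.2 + 1 = p.2 := congrArg Prod.snd he
    have h4 : ∀ k : Fin 4, k + 1 ≠ k := by decide
    exact h4 _ this

/-- **T2, the Umlaufsatz for cycles of the turning rule, by the polygonal route** (a second proof
of the statement `medialCycle_turning` of `WeightTable.lean`; the tree's discharge is
`medialCycle_turning_holds` in `MedialCycleHopf.lean`): around a cycle of minimal period `Q` of
`nextCorner β`, the signed number of quarter turns is `4` or `-4`. Proof: the perturbed polygon of
the cycle is a simple closed polygon whose exterior angles sum to `(π/2) ∑ turnSign`
(`sum_extAngle_cycVert`), and by Hopf's Umlaufsatz (`IsSimplePolygon.sum_extAngle_eq`) that sum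
is `±2π`. [cite: Hopf1935, Satz I] -/
theorem medialCycle_turning_of_polygonUmlaufsatz : medialCycle_turning := by
  intro β q Q hQ0 hP hmin
  have hQ2 : 2 ≤ Q := by
    by_contra hlt
    have hQ1 : Q = 1 := by omega
    subst hQ1
    exact nextCorner_ne_self β q hP
  have hsp := isSimplePolygon_cycVert hQ2 hP hmin
  have key := hsp.sum_extAngle_eq
  rw [sum_extAngle_cycVert hP] at key
  have hπ : Real.pi / 2 ≠ 0 := (half_pos Real.pi_pos).ne'
  rcases key with h | h
  · left
    have : (∑ m ∈ Finset.range Q, (turnSign β (cornerOrbit β q m) : ℝ)) = 4 := by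
      apply mul_left_cancel₀ hπ; linarith
    exact_mod_cast this
  · right
    have : (∑ m ∈ Finset.range Q, (turnSign β (cornerOrbit β q m) : ℝ)) = -4 := by
      apply mul_left_cancel₀ hπ; linarith
    exact_mod_cast this

end Literature.Probability.LatticeModels
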